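import Summits.BirchSwinnertonDyer.BirchSwinnertonDyer.Theorems.AlignedTransportAtTwoMainConjectureTransportAlignedAtTwoRhombicOfNegDisc
import HarnessLib

/-!
# Route `AlignedTransportAtTwo`, crux C1 (stmt-BirchSwinnertonDyer-22296): the SHAPE DICTIONARY completed —
# for `W/ℚ` without rational `2`-torsion and its newform `f`: `Λ_f` is rhombic ⟺ `Δ_W < 0` (and rectangular ⟺ `Δ_W > 0`)

HONEST FRAMING (cell `bsd-f1-sign2`, WIDTH-5 attach seat `bsd-line-att-p4` g8; `--supports stmt-BirchSwinnertonDyer-22296 --as helper`).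
THEOREMS ONLY (no `def`, no named fact, no `sorry`). BSD is NOT proved; nothing is closed. Companion of
`…AlignedTransportAtTwoRhombicOfNegDisc` (p639434: the direction `Δ_W < 0 ⇒ IsRhombic f` = `rhombicOfNegDisc_holds`). Here the converse: for
`Δ_W > 0` the Néron lattice is RECTANGULAR (`WeierstrassCurve.neronLattice_rectangular_of_Δ_neg`'s twin `…_of_Δ_pos`, RTT route) and rectangularity
passes along the same odd-degree isogeny / real-multiplier bridge (`rhombic_iff_of_odd_index`, `rhombic_iff_real_mul`), so `Λ_f` is rectangular,
i.e. `¬ IsRhombic f`. Net: **`isRhombic_iff_Δ_neg`** — the typed form of the cell's census «lattice index `i(M) = 2` on 420/420 `Δ < 0` rows vs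
`i = 1` on 146/146 `Δ > 0` rows (perfect separation)» (CANDIDATES.md IMC-A♮sym; MEMO-imc v2 §1: «the ± object at `2` is the index-`2` gluing of
`Λ_f` along its real and imaginary projections»), now a theorem for every curve without rational `2`-torsion.

WHAT.
* `isRhombic_periodPair_lattice_iff_of_latticeBridge` — along a bridge `αΛ_W ⊆ Λ`, `mΛ ⊆ αΛ_W` (`α ∈ ℝ^×`, `m` odd, `Λ_W` real): `Λ` rhombic
  ⟺ `Λ_W` rhombic.
* `exists_latticeBridge_of_isNewformOf` — for `W` without rational `2`-torsion and its newform `f`: a Néron-type `L_W` of `W`, a period pair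
  `L_f` spanning `Λ_f`, a real `α ≠ 0` and an odd `m` with `αΛ_W ⊆ Λ_f`, `mΛ_f ⊆ αΛ_W` (packaging of the proof of p639434).
* `not_isRhombic_of_Δ_pos_of_forall_not_hasRationalTwoTorsionX` — `Δ_W > 0` ⇒ `¬ IsRhombic f`.
* **`isRhombic_iff_Δ_neg`** — `IsRhombic f ↔ W.Δ < 0` (no rational `2`-torsion; `Δ_W ≠ 0`).

References: [CremonaAlgorithms1997] §2.10 (pp. 29–30); [SilvermanAEC2009] VI.4.1(b), III.4.11.
-/

set_option autoImplicit false
-- the route's Theorems namespace repeats a component by design (summit = sub-problem, D-0017).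
set_option linter.dupNamespace false

noncomputable section

open scoped Classical MatrixGroups ModularForm ComplexConjugate

open CongruenceSubgroup Complex WeierstrassCurve
open Literature.NumberTheory.EllipticCurves Literature.NumberTheory.EllipticCurves.ModularForms
  Literature.NumberTheory.EllipticCurves.Greenberg1999
  Summit.BirchSwinnertonDyer.Rank1Residual.F1Sign2
  Summit.BirchSwinnertonDyer.BirchSwinnertonDyer.Theorems.ThetaLayerLambdaCongruenceAtTwo
  Summit.BirchSwinnertonDyer.BirchSwinnertonDyer.Theorems.AlignedTransportAtTwoRhombicOfNegDisc

namespace Summit.BirchSwinnertonDyer.BirchSwinnertonDyer.Theorems.AlignedTransportAtTwoRhombicOfNegDiscIff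

/-- **Rhombicity along an odd real bridge.** `L_W` a real period pair, `Λ ≤ ℂ` any subgroup, `α ∈ ℝ^×`, `m` odd, `αΛ_W ⊆ Λ` and `m·Λ ⊆ αΛ_W`:
then `Λ` is rhombic iff `Λ_W` is (real scaling `rhombic_iff_real_mul` + odd index `rhombic_iff_of_odd_index`; `Λ` is automatically
conjugation-stable on the relevant elements only through `αΛ_W`, so the statement asks it explicitly). [folklore] -/
theorem rhombic_iff_of_latticeBridge {LW : PeriodPair} (hLWreal : LW.IsReal) (Λ : AddSubgroup ℂ) (hΛconj : ∀ z ∈ Λ, conj z ∈ Λ)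
    {α : ℝ} (hα : α ≠ 0) {m : ℕ} (hm : Odd m) (hWΛ : ∀ z ∈ LW.lattice, (α : ℂ) * z ∈ Λ)
    (hΛW : ∀ b ∈ Λ, ∃ z ∈ LW.lattice, (m : ℂ) * b = (α : ℂ) * z) :
    (∃ z ∈ Λ, ∀ w ∈ Λ, z + conj z ≠ 2 * w) ↔ (∃ z ∈ LW.lattice, ∀ w ∈ LW.lattice, z + conj z ≠ 2 * w) := by
  set B₁ : AddSubgroup ℂ := (LW.lattice.toAddSubgroup).map (AddMonoidHom.mulLeft (α : ℂ)) with hB₁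
  have hB₁mem : ∀ z, z ∈ B₁ ↔ ∃ a ∈ LW.lattice.toAddSubgroup, z = (α : ℂ) * a := fun z ↦ by
    simp only [hB₁, AddSubgroup.mem_map, AddMonoidHom.coe_mulLeft]
    exact ⟨fun ⟨a, ha, e⟩ ↦ ⟨a, ha, e.symm⟩, fun ⟨a, ha, e⟩ ↦ ⟨a, ha, e.symm⟩⟩
  have h1 : (∃ z ∈ LW.lattice.toAddSubgroup, ∀ w ∈ LW.lattice.toAddSubgroup, z + conj z ≠ 2 * w) ↔
      (∃ z ∈ B₁, ∀ w ∈ B₁, z + conj z ≠ 2 * w) :=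
    rhombic_iff_real_mul (A := LW.lattice.toAddSubgroup) hα hB₁mem
  have hB₁le : B₁ ≤ Λ := fun z hz ↦ by
    obtain ⟨a, ha, rfl⟩ := (hB₁mem z).mp hz
    exact hWΛ a ha
  have hB₁conj : ∀ z ∈ B₁, conj z ∈ B₁ := fun z hz ↦ by
    obtain ⟨a, ha, rfl⟩ := (hB₁mem z).mp hz
    exact (hB₁mem _).mpr ⟨conj a, hLWreal a ha, by rw [map_mul, Complex.conj_ofReal]⟩
  have hmB : ∀ b ∈ Λ, (m : ℂ) * b ∈ B₁ := fun b hb ↦ by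
    obtain ⟨z, hz, e⟩ := hΛW b hb
    exact (hB₁mem _).mpr ⟨z, hz, e⟩
  have h2 := rhombic_iff_of_odd_index hB₁le hΛconj hB₁conj hm hmB
  exact h2.trans h1.symm

/-- **The odd real bridge `Λ_W ⟶ Λ_f` exists for every `W/ℚ` without rational `2`-torsion and its newform `f`** (the packaging of the
proof of `isRhombic_of_Δ_neg_of_forall_not_hasRationalTwoTorsionX`, p639434): a Néron-type period pair `L_W` of `W ⊗ ℂ`, a period pair `L_f`
with `L_f.lattice = Λ_f`, a real `α ≠ 0` and an ODD `m` with `αΛ_W ⊆ Λ_f` and `m·Λ_f ⊆ αΛ_W` — `E_f = ℂ/Λ_f` over `ℚ`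
(`IsNewform0.exists_shortModel_periodLattice`), `cΛ_f ⊆ Λ_W` (`IsNewformOf.exists_maninConstant_ne_zero_holds`), an odd-degree `ℚ`-isogeny
`W → E_f` (`exists_isogeny_odd_degree_of_ratTwoTorsionCard_eq_one`) and its real multiplier (`Isogeny.exists_real_mul_lattice_le_of_isNeronLatticeOf`).
[cite: SilvermanAEC2009, Thm. VI.4.1(b), Cor. III.4.11] [cite: CremonaAlgorithms1997, §2.14] -/
theorem exists_latticeBridge_of_isNewformOf (W : WeierstrassCurve ℚ) [W.IsElliptic] (ht : ∀ x : ℚ, ¬ HasRationalTwoTorsionX W x)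
    {N : ℕ} [NeZero N] (f : CuspForm (Gamma0 N) 2) (hf : IsNewformOf W f) :
    ∃ (LW Lf : PeriodPair) (α : ℝ) (m : ℕ), IsNeronLatticeOf (W.baseChange ℂ) LW ∧
      (∀ z : ℂ, z ∈ Lf.lattice ↔ z ∈ periodLattice f) ∧ α ≠ 0 ∧ Odd m ∧
      (∀ z ∈ LW.lattice, (α : ℂ) * z ∈ Lf.lattice) ∧
      ∀ b ∈ Lf.lattice, ∃ z ∈ LW.lattice, (m : ℂ) * b = (α : ℂ) * z := by
  haveI : (W.baseChange ℂ).IsElliptic := by rw [WeierstrassCurve.baseChange]; infer_instance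
  obtain ⟨LW, hLW⟩ := exists_isNeronLatticeOf_holds (W.baseChange ℂ)
  obtain ⟨Lf, a₄, a₆, hΛ, hE, hLf⟩ := hf.1.exists_shortModel_periodLattice hf.coeffField_eq_bot
  haveI := hE
  have hmemf : ∀ z : ℂ, z ∈ Lf.lattice ↔ z ∈ periodLattice f := fun z ↦ by
    rw [← Submodule.mem_toAddSubgroup, hΛ]
  obtain ⟨c, hc0, hc⟩ := IsNewformOf.exists_maninConstant_ne_zero_holds hf hLW
  have hiso : IsIsogenous ({ a₁ := 0, a₂ := 0, a₃ := 0, a₄ := a₄, a₆ := a₆ } : WeierstrassCurve ℚ) W :=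
    isIsogenous_of_forall_mul_mem_lattice hLf.1 hLf.2 hLW.1 hLW.2 (c := (c : ℚ)) (by exact_mod_cast hc0)
      fun z hz ↦ by
        rw [Rat.cast_intCast]
        exact hc z ((hmemf z).mp hz)
  obtain ⟨ψ₀⟩ := hiso
  obtain ⟨ψ⟩ := ψ₀.nonempty_symm_of_isElliptic
  obtain ⟨φ, hodd⟩ := exists_isogeny_odd_degree_of_ratTwoTorsionCard_eq_one
    (ratTwoTorsionCard_eq_one_of_forall_not_hasRationalTwoTorsionX W ht) ψ
  obtain ⟨α, hα, hWf, hfW⟩ := φ.exists_real_mul_lattice_le_of_isNeronLatticeOf hLW hLf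
  exact ⟨LW, Lf, α, φ.degree, hLW, hmemf, hα, hodd, hWf, hfW⟩

/-- **`Δ_W > 0` and no rational `2`-torsion abscissa ⇒ `Λ_f` is RECTANGULAR (`¬ IsRhombic f`)** for every newform `f` of `W`: the Néron lattice
`Λ_W` is rectangular (`WeierstrassCurve.neronLattice_rectangular_of_Δ_pos`), and rectangularity passes along the odd real bridge
(`rhombic_iff_of_latticeBridge`); finally `re z ∉ Λ_f` would give `z + z̄ = 2·re z ∉ 2Λ_f`. Twin of `rhombicOfNegDisc_holds`.
[cite: CremonaAlgorithms1997, §2.10 (pp. 29–30)] [cite: SilvermanAEC2009, Thm. VI.4.1(b), Cor. III.4.11] -/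
theorem not_isRhombic_of_Δ_pos_of_forall_not_hasRationalTwoTorsionX (W : WeierstrassCurve ℚ) [W.IsElliptic] (hΔ : 0 < W.Δ)
    (ht : ∀ x : ℚ, ¬ HasRationalTwoTorsionX W x) {N : ℕ} [NeZero N] (f : CuspForm (Gamma0 N) 2) (hf : IsNewformOf W f) :
    ¬ IsRhombic f := by
  obtain ⟨LW, Lf, α, m, hLW, hmemf, hα, hm, hWf, hfW⟩ := exists_latticeBridge_of_isNewformOf W ht f hf
  have hLWreal : LW.IsReal := WeierstrassCurve.isReal_of_g₂_g₃_eq (K := ℚ) hLW.1 hLW.2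
  have hrect := W.neronLattice_rectangular_of_Δ_pos hΔ hLW
  -- `Λ_f` is conjugation-stable
  have hconj : ∀ z ∈ Lf.lattice.toAddSubgroup, conj z ∈ Lf.lattice.toAddSubgroup := fun z hz ↦ by
    rw [Submodule.mem_toAddSubgroup, hmemf] at hz ⊢
    exact conj_mem_periodLattice_holds (f := f) hf.1 hf.coeffField_eq_bot hz
  have hiff := rhombic_iff_of_latticeBridge hLWreal Lf.lattice.toAddSubgroup hconj hα hm hWf hfW
  rintro ⟨z, hz, hzre⟩
  -- `z ∈ Λ_f` with `re z ∉ Λ_f` makes `Λ_f` rhombic in the `z + z̄` spelling, hence `Λ_W` rhombic: contradiction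
  have hrh : ∃ z ∈ Lf.lattice.toAddSubgroup, ∀ w ∈ Lf.lattice.toAddSubgroup, z + conj z ≠ 2 * w := by
    refine ⟨z, by rw [Submodule.mem_toAddSubgroup, hmemf]; exact hz, fun w hw e ↦ hzre ?_⟩
    rw [Submodule.mem_toAddSubgroup, hmemf] at hw
    have e' : ((z.re : ℂ)) = w := by
      have h2 : z + conj z = ((2 * z.re : ℝ) : ℂ) := Complex.add_conj z
      rw [h2] at e
      push_cast at e
      linear_combination e / 2
    rw [e']
    exact hw
  obtain ⟨z', hz', hzw'⟩ := hiff.mp hrh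
  obtain ⟨w', hw', e'⟩ := hrect z' hz'
  exact hzw' w' hw' e'

/-- **The shape dictionary: `IsRhombic f ↔ Δ_W < 0`** for every elliptic `W/ℚ` without rational `2`-torsion abscissa and every newform `f`
of `W` (`Δ_W ≠ 0`; `⇐` is `rhombicOfNegDisc_holds`, `⇒` is the rectangular twin). This is the theorem behind the cell's census «lattice index
`2` on every `Δ < 0` row, `1` on every `Δ > 0` row» for curves with `E(ℚ)[2] = 0`. [cite: CremonaAlgorithms1997, §2.10 (pp. 29–30)] -/
theorem isRhombic_iff_Δ_neg (W : WeierstrassCurve ℚ) [W.IsElliptic] (ht : ∀ x : ℚ, ¬ HasRationalTwoTorsionX W x) {N : ℕ} [NeZero N]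
    (f : CuspForm (Gamma0 N) 2) (hf : IsNewformOf W f) : IsRhombic f ↔ W.Δ < 0 := by
  refine ⟨fun h ↦ ?_, fun hΔ ↦ isRhombic_of_Δ_neg_of_forall_not_hasRationalTwoTorsionX W hΔ ht f hf⟩
  by_contra hΔ
  have hpos : 0 < W.Δ := lt_of_le_of_ne (not_lt.mp hΔ) (W.isUnit_Δ.ne_zero).symm
  exact not_isRhombic_of_Δ_pos_of_forall_not_hasRationalTwoTorsionX W hpos ht f hf h

/-! ## Appendix (att-p4 g8, same session): the odd real bridge for ANY isogenous target, WITHOUT a cyclicity hypothesis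

The RTT route's `exists_real_oddIndex_latticeBridge_of_goodSS_two` (`…ThetaLayerLambdaCongruenceAtTwoStarOddIsogeny`, (H2) of ITEM B5 of crux
`ThetaLayerLambdaCongruenceAtTwo`) asks for a CYCLIC `ℚ`-isogeny `ψ : W → A` (supplied there by the named fact `mazurKenku_exists_cyclic_isogeny`).
Cyclicity is not needed: with no rational `2`-torsion on `W` ANY isogeny class member `A` receives an isogeny of ODD degree from `W`
(`exists_isogeny_odd_degree_of_ratTwoTorsionCard_eq_one`, p639434), whose real multiplier gives the bridge. -/

/-- **The odd real bridge `Λ_W ⟶ Λ_A` for every curve `A` that is `ℚ`-isogenous to a curve `W` without rational `2`-torsion** — no cyclicity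
hypothesis, no Mazur–Kenku: for Néron-type period pairs `L_W`, `L_A` there are a real `α ≠ 0` and an ODD `m` with `αΛ_W ⊆ Λ_A` and `m·Λ_A ⊆ αΛ_W`.
(`IsIsogenous W A` ⟶ some isogeny ⟶ one of odd degree `m` by `exists_isogeny_odd_degree_of_ratTwoTorsionCard_eq_one` ⟶ its real multiplier,
`Isogeny.exists_real_mul_lattice_le_of_isNeronLatticeOf`.) Drop-in replacement for `exists_real_oddIndex_latticeBridge_of_goodSS_two` with the
`hcyc` binder removed (good supersingular at `2` gives `ratTwoTorsionCard W = 1` by `ratTwoTorsionCard_eq_one_of_goodSS_two`).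
[cite: SilvermanAEC2009, Thm. VI.4.1(b), Cor. III.4.11] -/
theorem exists_real_oddIndex_latticeBridge_of_ratTwoTorsionCard_eq_one (W A : WeierstrassCurve ℚ) [W.IsElliptic] [A.IsElliptic]
    (h1 : ratTwoTorsionCard W = 1) (hiso : IsIsogenous W A) {LW LA : PeriodPair} (hLW : IsNeronLatticeOf (W.baseChange ℂ) LW)
    (hLA : IsNeronLatticeOf (A.baseChange ℂ) LA) :
    ∃ (α : ℝ) (m : ℕ), α ≠ 0 ∧ Odd m ∧ (∀ z ∈ LW.lattice, (α : ℂ) * z ∈ LA.lattice) ∧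
      ∀ b ∈ LA.lattice, ∃ z ∈ LW.lattice, (m : ℂ) * b = (α : ℂ) * z := by
  obtain ⟨ψ₀⟩ := hiso
  obtain ⟨ψ, hodd⟩ := exists_isogeny_odd_degree_of_ratTwoTorsionCard_eq_one h1 ψ₀
  obtain ⟨α, hα, hincl, hidx⟩ := ψ.exists_real_mul_lattice_le_of_isNeronLatticeOf hLW hLA
  exact ⟨α, ψ.degree, hα, hodd, hincl, hidx⟩

/-- **(H2) of the RTT route's ITEM B5 for a curve good supersingular at `2`, cyclicity-free**: same conclusion as
`exists_real_oddIndex_latticeBridge_of_goodSS_two` for ANY `ℚ`-isogenous `A` (no `ψ.IsCyclic`, hence no Mazur–Kenku input).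
[cite: SilvermanAEC2009, Thm. VI.4.1(b), Cor. III.4.11 and VII.3] -/
theorem exists_real_oddIndex_latticeBridge_of_goodSS_two' (W A : WeierstrassCurve ℚ) [W.IsElliptic] [W.IsGloballyMinimal] [A.IsElliptic]
    (hss : Literature.NumberTheory.EllipticCurves.Rank1Residual.GoodSS W 2) (hiso : IsIsogenous W A) {LW LA : PeriodPair}
    (hLW : IsNeronLatticeOf (W.baseChange ℂ) LW) (hLA : IsNeronLatticeOf (A.baseChange ℂ) LA) :
    ∃ (α : ℝ) (m : ℕ), α ≠ 0 ∧ Odd m ∧ (∀ z ∈ LW.lattice, (α : ℂ) * z ∈ LA.lattice) ∧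
      ∀ b ∈ LA.lattice, ∃ z ∈ LW.lattice, (m : ℂ) * b = (α : ℂ) * z :=
  exists_real_oddIndex_latticeBridge_of_ratTwoTorsionCard_eq_one W A (ratTwoTorsionCard_eq_one_of_goodSS_two W hss) hiso hLW hLA

end Summit.BirchSwinnertonDyer.BirchSwinnertonDyer.Theorems.AlignedTransportAtTwoRhombicOfNegDiscIff

end
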